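import Summits.QuantumFields.YangMills.Theorems.BalabanLadderNTCeilingPrice
import HarnessLib

/-!
# Crux `NT` (stmt-QuantumFields-19353), stub `stub_refpkgT : RefPkgT`: the one-point ceiling prices the floors, II —
# witness geometry and the smeared caps `|Q2(θv, v)| ≤ S_θ S_v (2C₁/R⁴)²`, `|Q3(f, g, h)| ≤ S_f S_g S_h (2C₁/R⁴)³`

Helper file (`--supports stmt-QuantumFields-19353`) of the fleet lead prover of crux `NT` (unit `ym-spine-19353-p1`,
GEN 12); sequel of `…NTCeilingPrice` (E1-osc ⇒ `(2C₁/R⁴)ⁿ` centred-moment caps on every torus).  Hypothesis-free, general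
compact `G`, any `r`, one coupling `β`, spacing `s > 0`.

* `two_mul_norm_le_of_apply_ne_zero` — a lattice point charged by a witness supported in the ball of radius `σ` sits in the
  bulk (`2‖x‖_∞ ≤ L`) of every torus with `2σ ≤ sL`;
* `torusSep_of_timeGap` — pairs charged by `θv`, `v` (time gap `δ`: `v y ≠ 0 → δ ≤ y 0`) are torus-separated by `2R+4` in
  the time coordinate once `(R+2)s ≤ δ`;  `torusSep_of_sep` — pairs charged by `f`, `g` with supports `δ` apart
  (Euclidean) are torus-sup-separated by `2R+4` once `4(R+2)s ≤ δ` (`‖·‖₂ ≤ 2‖·‖_∞` on `ℤ⁴`);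
* **`abs_Q2_le_of_e1osc`** — E1-osc (`C₁`, range `ℓ`) at `β` ⇒ `|Q2_{β,L,s}(θv, v)| ≤ S_θ · S_v · (2C₁/R⁴)²` for every
  `R ≥ 1` with `(2R+3)s ≤ ℓ`, `4R+8 ≤ L`, `(R+2)s ≤ δ`, on every torus with `2σ ≤ sL` (`S_w = Σ_{x ∈ box L}|w(s x)|`);
* **`abs_Q3_le_of_e1osc`** — `|Q3_{β,L,s}(f, g, h)| ≤ S_f S_g S_h (2C₁/R⁴)³` for `4(R+2)s ≤ δ'` (pairwise separation `δ'`).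

With `R ≈ δ/s` and the ℓ¹-envelopes `S_w ≤ K_w/s⁴` both caps are β-UNIFORM numbers (`4C₁²K_θK_v/δ⁸`, `8·4¹²C₁³K_fK_gK_h/δ'¹²`):
the sequel `…NTCeilingPricePackage` reads them against the registered floors-with-margin.

HONEST FRAMING.  Bookkeeping over tree theorems at one coupling; no floor, no large-`β` ceiling, not AF, not NT, not the
seam, not the gap; not Clay.  Refs: `…NTReferenceMargins`, `…NTReferenceThreePointNoE2` (witness geometry),
`…LangevinControlUVOSLegsFromFemtoAndGapStubAssemblyUniformBoundMain` (no wrap-around), OsterwalderSeiler1978 §2.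
-/

set_option autoImplicit false

noncomputable section

open scoped SchwartzMap
open MeasureTheory Filter Topology
open Literature.MathematicalPhysics.QuantumFieldTheory Literature.MathematicalPhysics.QuantumLattice
open Literature.Probability.LatticeModels
open Summit.QuantumFields.YangMills.Cruxes.OSLegsFromFemtoAndGap.DlrCollarTransfer
open Summit.QuantumFields.YangMills.Theorems.OSLegsFromFemtoAndGap
  (exists_valMinAbs_ge_of_norm_le valMinAbs_intCast_of_abs_le mul_norm_le_norm_smul_siteToE norm_smul_siteToE_sub_le)
open Summit.QuantumFields.YangMills.Cruxes.NT.Reference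
  (two_mul_timeGap_le smul_siteToE_apply_zero norm_siteToE_le_of_apply_ne_zero sep_le_mul_norm)

namespace Summit.QuantumFields.YangMills.Cruxes.NT.CeilingPrice

/-! ## §3 Witness geometry: charged pairs are sup-separated on the torus -/

/-- A lattice point charged by a test function supported in the ball of radius `σ` (spacing `s > 0`) sits in the bulk of
every torus of half-side `L ≥ 2σ/s`: `2‖x‖_∞ ≤ L`. [folklore] -/
theorem two_mul_norm_le_of_apply_ne_zero {v : 𝓢(EuclideanSpace ℝ (Fin 4), ℝ)} {s σ : ℝ} (hs : 0 < s)
    (hvσ : tsupport (v : EuclideanSpace ℝ (Fin 4) → ℝ) ⊆ Metric.closedBall 0 σ) {L : ℕ} (hσL : 2 * σ ≤ s * L)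
    {x : Fin 4 → ℤ} (hx : v (s • siteToE x) ≠ 0) : 2 * ‖x‖ ≤ (L : ℝ) := by
  have h1 : s * ‖x‖ ≤ ‖s • siteToE x‖ := mul_norm_le_norm_smul_siteToE hs.le x
  have h2 : ‖s • siteToE x‖ ≤ σ := by
    have hmem := hvσ (subset_tsupport _ (Function.mem_support.2 hx))
    rwa [Metric.mem_closedBall, dist_zero_right] at hmem
  have h3 : s * (2 * ‖x‖) ≤ s * L := by linarith
  exact le_of_mul_le_mul_left h3 hs

/-- **Reflection-paired witness: torus separation in the time coordinate.**  If `v` has time gap `δ`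
(`v y ≠ 0 → δ ≤ y 0`) and support in the ball of radius `σ`, `s > 0`, `2σ ≤ sL`, `(R+2)s ≤ δ`, then every pair `x, y`
charged by `θv`, `v` satisfies `2R+4 ≤ |valMinAbs (x 0 − y 0)|` on the torus of side `2L+1`. [folklore] -/
theorem torusSep_of_timeGap {v : 𝓢(EuclideanSpace ℝ (Fin 4), ℝ)} {δ σ s : ℝ} (hs : 0 < s)
    (hvδ : ∀ y : EuclideanSpace ℝ (Fin 4), v y ≠ 0 → δ ≤ y 0)
    (hvσ : tsupport (v : EuclideanSpace ℝ (Fin 4) → ℝ) ⊆ Metric.closedBall 0 σ) {L R : ℕ} (hσL : 2 * σ ≤ s * L)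
    (hRδ : ((R : ℝ) + 2) * s ≤ δ) {x y : Fin 4 → ℤ} (hx : thetaTest 4 v (s • siteToE x) ≠ 0)
    (hy : v (s • siteToE y) ≠ 0) :
    ∃ k : Fin 4, (2 * (R : ℤ) + 4) ≤ |((((x k - y k : ℤ) : ZMod (2 * L + 1))).valMinAbs : ℤ)| := by
  refine ⟨0, ?_⟩
  -- time coordinates: `s x 0 ≤ -δ`, `δ ≤ s y 0`
  have hx0 : δ ≤ -(s * (x 0 : ℝ)) := by
    rw [thetaTest_apply] at hx
    have h1 := hvδ _ hx
    have h0 : (timeReflection 4 (s • siteToE x)) 0 = -((s • siteToE x) 0) := by simp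
    rwa [h0, smul_siteToE_apply_zero] at h1
  have hy0 : δ ≤ s * (y 0 : ℝ) := by
    have h2 := hvδ _ hy
    rwa [smul_siteToE_apply_zero] at h2
  -- no wrap-around: both time coordinates are at most `σ/s ≤ L/2` in absolute value
  have hσx : ‖s • siteToE x‖ ≤ σ := by
    have hx' : v (timeReflection 4 (s • siteToE x)) ≠ 0 := by rwa [thetaTest_apply] at hx
    have hmem := hvσ (subset_tsupport _ (Function.mem_support.2 hx'))
    rw [Metric.mem_closedBall, dist_zero_right] at hmem
    rwa [LinearIsometryEquiv.norm_map] at hmem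
  have hσy : ‖s • siteToE y‖ ≤ σ := by
    have hmem := hvσ (subset_tsupport _ (Function.mem_support.2 hy))
    rwa [Metric.mem_closedBall, dist_zero_right] at hmem
  have hax : |s * (x 0 : ℝ)| ≤ σ := by
    have h := PiLp.norm_apply_le (s • siteToE x) 0
    rw [smul_siteToE_apply_zero, Real.norm_eq_abs] at h
    exact h.trans hσx
  have hay : |s * (y 0 : ℝ)| ≤ σ := by
    have h := PiLp.norm_apply_le (s • siteToE y) 0
    rw [smul_siteToE_apply_zero, Real.norm_eq_abs] at h
    exact h.trans hσy
  have habs : |x 0 - y 0| ≤ (L : ℤ) := by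
    have h1 : s * |((x 0 - y 0 : ℤ) : ℝ)| ≤ s * L := by
      push_cast
      rw [← abs_of_pos hs, ← abs_mul, mul_sub, abs_of_pos hs]
      calc |s * (x 0 : ℝ) - s * (y 0 : ℝ)| ≤ |s * (x 0 : ℝ)| + |s * (y 0 : ℝ)| := abs_sub _ _
        _ ≤ σ + σ := add_le_add hax hay
        _ ≤ s * L := by linarith
    exact_mod_cast le_of_mul_le_mul_left h1 hs
  rw [valMinAbs_intCast_of_abs_le habs]
  -- separation: `s (y 0 - x 0) ≥ 2δ ≥ (2R+4) s`
  have hdiff : ((2 * (R : ℤ) + 4 : ℤ) : ℝ) * s ≤ s * (((y 0 - x 0 : ℤ)) : ℝ) := by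
    push_cast
    nlinarith
  have h2 : ((2 * (R : ℤ) + 4 : ℤ) : ℝ) ≤ (((y 0 - x 0 : ℤ)) : ℝ) := by
    rw [mul_comm] at hdiff
    exact le_of_mul_le_mul_left hdiff hs
  have h3 : (2 * (R : ℤ) + 4) ≤ y 0 - x 0 := by exact_mod_cast h2
  rw [abs_sub_comm]
  exact h3.trans (le_abs_self _)

/-- **Two witnesses with separated supports: torus separation in some coordinate.**  If `f p ≠ 0`, `g q ≠ 0` force
`δ ≤ ‖p − q‖`, both supports lie in the ball of radius `σ`, `s > 0`, `2σ ≤ sL` and `4(R+2)s ≤ δ`, then every pair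
charged by `f`, `g` is sup-separated by `2R+4` on the torus (`‖·‖₂ ≤ 2‖·‖_∞` on `ℤ⁴`, no wrap-around in the bulk).
[folklore] -/
theorem torusSep_of_sep {f g : 𝓢(EuclideanSpace ℝ (Fin 4), ℝ)} {δ σ s : ℝ} (hs : 0 < s)
    (hfg : ∀ p q : EuclideanSpace ℝ (Fin 4), f p ≠ 0 → g q ≠ 0 → δ ≤ ‖p - q‖)
    (hfσ : tsupport (f : EuclideanSpace ℝ (Fin 4) → ℝ) ⊆ Metric.closedBall 0 σ)
    (hgσ : tsupport (g : EuclideanSpace ℝ (Fin 4) → ℝ) ⊆ Metric.closedBall 0 σ) {L R : ℕ} (hσL : 2 * σ ≤ s * L)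
    (hRδ : 4 * (((R : ℝ) + 2) * s) ≤ δ) {x y : Fin 4 → ℤ} (hx : f (s • siteToE x) ≠ 0) (hy : g (s • siteToE y) ≠ 0) :
    ∃ k : Fin 4, (2 * (R : ℤ) + 4) ≤ |((((x k - y k : ℤ) : ZMod (2 * L + 1))).valMinAbs : ℤ)| := by
  have hwrap : ∀ i : Fin 2, 2 * ‖![x, y] i‖ ≤ (L : ℝ) := by
    intro i
    fin_cases i
    · simpa using two_mul_norm_le_of_apply_ne_zero hs hfσ hσL hx
    · simpa using two_mul_norm_le_of_apply_ne_zero hs hgσ hσL hy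
  have hsup : ((2 * (R : ℤ) + 4 : ℤ) : ℝ) ≤ ‖![x, y] 0 - ![x, y] 1‖ := by
    have h1 : δ ≤ ‖s • siteToE x - s • siteToE y‖ := hfg _ _ hx hy
    have h2 : ‖s • siteToE x - s • siteToE y‖ ≤ 2 * s * ‖x - y‖ := norm_smul_siteToE_sub_le hs.le x y
    have h3 : s * (4 * ((R : ℝ) + 2)) ≤ s * (2 * ‖x - y‖) := by nlinarith
    have h4 := le_of_mul_le_mul_left h3 hs
    simp only [Matrix.cons_val_zero, Matrix.cons_val_one]
    push_cast
    linarith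
  obtain ⟨k, hk⟩ := exists_valMinAbs_ge_of_norm_le ![x, y] hwrap 0 1 hsup
  refine ⟨k, ?_⟩
  simp only [Matrix.cons_val_zero, Matrix.cons_val_one] at hk
  exact_mod_cast hk

/-! ## §4 The smeared caps at one coupling -/

section Smeared

variable (G : Type) [Group G] [TopologicalSpace G] [IsTopologicalGroup G] [CompactSpace G]
  [MeasurableSpace G] [BorelSpace G] (r : LatticeRep G)

/-- **E1-osc caps the reflection-paired two-point function**: at coupling `β`, spacing `s > 0`, if every femto cube
(`b·s ≤ ℓ`) obeys the one-point oscillation ceiling with constant `C₁ ≥ 0`, then for a witness `v` with time gap `δ` and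
support in the ball of radius `σ`, on every torus with `2σ ≤ sL`, for every `R ≥ 1` with `(2R+3)s ≤ ℓ`, `4R+8 ≤ L`,
`(R+2)s ≤ δ`:  `|Q2_{β,L,s}(θv, v)| ≤ S_θ · S_v · (2C₁/R⁴)²`. [folklore] -/
theorem abs_Q2_le_of_e1osc (β : ℝ) {C₁ ℓ s : ℝ} (hC₁ : 0 ≤ C₁) (hs : 0 < s)
    (hE1 : ∀ (c : Fin 4 → ℤ) (b : ℕ), (b : ℝ) * s ≤ ℓ → ∀ (η η' : LGConfig 4 G) (x : Fin 4 → ℤ),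
      1 ≤ depth c b x → |kerE G r β c b η (dens G r x) - kerE G r β c b η' (dens G r x)| ≤ C₁ / (depth c b x : ℝ) ^ 4)
    {v : 𝓢(EuclideanSpace ℝ (Fin 4), ℝ)} {δ σ : ℝ} (hvδ : ∀ y : EuclideanSpace ℝ (Fin 4), v y ≠ 0 → δ ≤ y 0)
    (hvσ : tsupport (v : EuclideanSpace ℝ (Fin 4) → ℝ) ⊆ Metric.closedBall 0 σ) {L R : ℕ} (hσL : 2 * σ ≤ s * L)
    (hR : 1 ≤ R) (hRℓ : ((2 * R + 3 : ℕ) : ℝ) * s ≤ ℓ) (hRL : 4 * R + 8 ≤ L) (hRδ : ((R : ℝ) + 2) * s ≤ δ) :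
    |Q2 G r β L s (thetaTest 4 v) v| ≤
      (∑ x ∈ box 4 L, |thetaTest 4 v (s • siteToE x)|) * (∑ y ∈ box 4 L, |v (s • siteToE y)|) *
        (2 * C₁ / (R : ℝ) ^ 4) ^ 2 :=
  abs_Q2_le_of_pointwise G r β L s (thetaTest 4 v) v fun x _ y _ hx hy =>
    abs_torusCov_dens_le_of_e1osc G r β hC₁ hE1 x y hR hRℓ hRL (torusSep_of_timeGap hs hvδ hvσ hσL hRδ hx hy)

/-- **E1-osc caps the three-point function of separated witnesses**: at coupling `β`, spacing `s > 0`, one-point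
oscillation ceiling with constant `C₁ ≥ 0` on femto cubes (`b·s ≤ ℓ`); `f, g, h` supported in the ball of radius `σ` with
pairwise support separation `δ`; torus with `2σ ≤ sL`; `R ≥ 1`, `(2R+3)s ≤ ℓ`, `4R+8 ≤ L`, `4(R+2)s ≤ δ`:
`|Q3_{β,L,s}(f, g, h)| ≤ S_f · S_g · S_h · (2C₁/R⁴)³`. [folklore] -/
theorem abs_Q3_le_of_e1osc (β : ℝ) {C₁ ℓ s : ℝ} (hC₁ : 0 ≤ C₁) (hs : 0 < s)
    (hE1 : ∀ (c : Fin 4 → ℤ) (b : ℕ), (b : ℝ) * s ≤ ℓ → ∀ (η η' : LGConfig 4 G) (x : Fin 4 → ℤ),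
      1 ≤ depth c b x → |kerE G r β c b η (dens G r x) - kerE G r β c b η' (dens G r x)| ≤ C₁ / (depth c b x : ℝ) ^ 4)
    {f g h : 𝓢(EuclideanSpace ℝ (Fin 4), ℝ)} {δ σ : ℝ}
    (hfg : ∀ p q : EuclideanSpace ℝ (Fin 4), f p ≠ 0 → g q ≠ 0 → δ ≤ ‖p - q‖)
    (hgh : ∀ p q : EuclideanSpace ℝ (Fin 4), g p ≠ 0 → h q ≠ 0 → δ ≤ ‖p - q‖)
    (hfh : ∀ p q : EuclideanSpace ℝ (Fin 4), f p ≠ 0 → h q ≠ 0 → δ ≤ ‖p - q‖)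
    (hfσ : tsupport (f : EuclideanSpace ℝ (Fin 4) → ℝ) ⊆ Metric.closedBall 0 σ)
    (hgσ : tsupport (g : EuclideanSpace ℝ (Fin 4) → ℝ) ⊆ Metric.closedBall 0 σ)
    (hhσ : tsupport (h : EuclideanSpace ℝ (Fin 4) → ℝ) ⊆ Metric.closedBall 0 σ) {L R : ℕ} (hσL : 2 * σ ≤ s * L)
    (hR : 1 ≤ R) (hRℓ : ((2 * R + 3 : ℕ) : ℝ) * s ≤ ℓ) (hRL : 4 * R + 8 ≤ L) (hRδ : 4 * (((R : ℝ) + 2) * s) ≤ δ) :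
    |Q3 G r β L s f g h| ≤
      (∑ x ∈ box 4 L, |f (s • siteToE x)|) * (∑ y ∈ box 4 L, |g (s • siteToE y)|) *
        (∑ z ∈ box 4 L, |h (s • siteToE z)|) * (2 * C₁ / (R : ℝ) ^ 4) ^ 3 :=
  abs_Q3_le_of_pointwise G r β L s f g h fun x _ y _ z _ hx hy hz =>
    abs_torusK3_le_of_e1osc G r β hC₁ hE1 x y z hR hRℓ hRL (torusSep_of_sep hs hfg hfσ hgσ hσL hRδ hx hy)
      (torusSep_of_sep hs hgh hgσ hhσ hσL hRδ hy hz) (torusSep_of_sep hs hfh hfσ hhσ hσL hRδ hx hz)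

end Smeared

end Summit.QuantumFields.YangMills.Cruxes.NT.CeilingPrice

end
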